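import Literature.AlgebraicGeometry.Frobenioids.Composites
import Literature.AlgebraicGeometry.Frobenioids.PreFrobenioidPullbacks
import Mathlib.CategoryTheory.Comma.Arrow
import HarnessLib

/-!
# Frobenioids I, Proposition 1.8: pre-steps
# (STEP-0 calibration fragment of the abc-iut cell — axiomatic-proof genre)

Mochizuki, *The geometry of Frobenioids I: the general theory*, Kyushu J. Math. **62** (2008)
293–400, §1, Proposition 1.8 "(Pre-steps)" and its proof, kurims text p. 30
[cite: MochizukiFrdI2008, Prop. 1.8]:

> "Let `Φ` be a divisorial monoid on a connected, totally epimorphic category `D`; `C → F_Φ` a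
> Frobenioid. Then: (i) If the natural projection functor `C → D` is full, then every pre-step of
> `C` is a linear End-equivalence. If `D` is of Aut-type [cf. §0], then every linear
> End-equivalence of `C` is a pre-step. (ii) Suppose further that `C` is of metrically trivial and
> Aut-ample type. Then a morphism of `C` is a co-angular pre-step if and only if it is abstractly
> equivalent [cf. §0] to a base-identity pre-step endomorphism of `C`. (iii) An object
> `A ∈ Ob(C)` is non-group-like if and only if there exists a co-angular step `A → B`;
> alternatively, an object `A ∈ Ob(C)` is non-group-like if and only if there exists a co-angular
> step `B → A`. Also, if `A, B ∈ Ob(C)` are base-isomorphic objects, then `A` is group-like if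
> and only if `B` is."

The Lean proof follows the printed one ("formally from the definitions"; (ii) via metric
triviality, Aut-ampleness and Def. 1.3 (iii)(b); (iii) via the equivalences of categories of
Def. 1.3 (iii)(d), here the essential-surjectivity clauses, together with Prop. 1.4 (iii)).
Rendering notes: the second sentence of (i) also uses that `D` is totally epimorphic (a standing
hypothesis); in (ii) "abstractly equivalent to a base-identity pre-step endomorphism" is rendered
with an existential over the object carrying the endomorphism. No statement of the paper is
strengthened.
-/

namespace Literature.AlgebraicGeometry.Frobenioids

open CategoryTheory Opposite

universe w v v' u u'

namespace PreFrobenioid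

variable {D : Type u} [Category.{v} D] {Φ : Dᵒᵖ ⥤ CommMonCat.{w}}
  {C : Type u'} [Category.{v'} C] (F : C ⥤ ElemFrobenioid Φ)

/-! ### Proposition 1.8 (i) -/

/-- **Prop. 1.8 (i)**, first sentence: if `C → D` is full, every pre-step is a linear
End-equivalence. [cite: MochizukiFrdI2008, Prop. 1.8] -/
theorem isLinear_and_isEndEquivalence_of_isPreStep [(baseFunctor F).Full] {A B : C} (φ : A ⟶ B)
    (h : IsPreStep F φ) : IsLinear F φ ∧ IsEndEquivalence φ := by
  haveI : IsIso (Base F φ) := h.2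
  obtain ⟨ψ, _⟩ := (baseFunctor F).map_surjective (inv (Base F φ) : baseObj F B ⟶ baseObj F A)
  exact ⟨h.1, ⟨ψ⟩⟩

/-- **Prop. 1.8 (i)**, second sentence: if `D` is of Aut-type (and totally epimorphic), every
linear End-equivalence is a pre-step. [cite: MochizukiFrdI2008, Prop. 1.8] -/
theorem isPreStep_of_isLinear_of_isEndEquivalence (hDa : IsOfAutType D) (hDe : IsTotallyEpimorphic D)
    {A B : C} (φ : A ⟶ B) (h₁ : IsLinear F φ) (h₂ : IsEndEquivalence φ) : IsPreStep F φ := by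
  obtain ⟨ψ⟩ := h₂
  haveI : IsIso (Base F φ ≫ Base F ψ) := hDa.obj (baseObj F A) _
  exact ⟨h₁, (hDe.isIso_of_isIso_comp (Base F φ) (Base F ψ)).2⟩

/-! ### Proposition 1.8 (ii) -/

/-- **Prop. 1.8 (ii)**: in a Frobenioid of metrically trivial and Aut-ample type, `φ` is a
co-angular pre-step iff it is abstractly equivalent to a base-identity pre-step endomorphism.
[cite: MochizukiFrdI2008, Prop. 1.8] -/
theorem isCoAngularPreStep_iff_isAbstractlyEquivalent (hF : IsFrobenioid F)
    (hmt : IsOfType (IsMetricallyTrivial F)) (haa : IsOfType (IsAutAmple F)) {A B : C} (φ : A ⟶ B) :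
    IsCoAngularPreStep F φ ↔
      ∃ (A' : C) (ψ : A' ⟶ A'), IsBaseIdentity F ψ ∧ IsPreStep F ψ ∧ IsAbstractlyEquivalent φ ψ := by
  have hC : IsTotallyEpimorphic C := hF.isPreFrobenioid.isTotallyEpimorphic
  constructor
  · rintro ⟨hco, hpre⟩
    obtain ⟨i⟩ := hmt A φ hco hpre
    haveI : IsIso (Base F φ) := hpre.2
    haveI : IsIso (Base F (φ ≫ i.hom)) := IsBaseIso.comp F hpre.2 (isBaseIso_of_isIso F i.hom)
    obtain ⟨j, hj⟩ := haa A (asIso (Base F (φ ≫ i.hom))).symm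
    have hjh : Base F j.hom = inv (Base F (φ ≫ i.hom)) := congrArg Iso.hom hj
    refine ⟨A, φ ≫ i.hom ≫ j.hom, ?_, ?_, ⟨Arrow.isoMk (Iso.refl A) (i ≪≫ j) ?_⟩⟩
    · show Base F (φ ≫ i.hom ≫ j.hom) = 𝟙 _
      rw [← Category.assoc, base_comp, hjh, IsIso.hom_inv_id]
    · exact IsPreStep.comp F hpre (IsPreStep.comp F (isPreStep_of_isIso F i.hom)
        (isPreStep_of_isIso F j.hom))
    · show 𝟙 A ≫ φ ≫ i.hom ≫ j.hom = φ ≫ i.hom ≫ j.hom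
      rw [Category.id_comp]
  · rintro ⟨A', ψ, _, hψpre, ⟨e⟩⟩
    let l : A ⟶ A' := e.hom.left
    let r : B ⟶ A' := e.hom.right
    haveI : IsIso l := (Arrow.leftFunc.mapIso e).isIso_hom
    haveI : IsIso r := (Arrow.rightFunc.mapIso e).isIso_hom
    have hw : l ≫ ψ = φ ≫ r := Arrow.w e.hom
    have hφ : φ = l ≫ ψ ≫ inv r := by
      rw [← Category.assoc, hw, Category.assoc, IsIso.hom_inv_id, Category.comp_id]
    have hψco : IsCoAngular F ψ := isCoAngular_endo F hF ψ
    rw [hφ]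
    refine ⟨hF.iii_a _ _ (isCoAngular_of_isIso F hC l)
      (hF.iii_a _ _ hψco (isCoAngular_of_isIso F hC (inv r))), ?_⟩
    exact IsPreStep.comp F (isPreStep_of_isIso F l)
      (IsPreStep.comp F hψpre (isPreStep_of_isIso F (inv r)))

/-! ### Proposition 1.8 (iii) -/

/-- **Prop. 1.8 (iii)**: `A` is non-group-like iff there is a co-angular step `A → B`.
[cite: MochizukiFrdI2008, Prop. 1.8] -/
theorem not_isGroupLikeObj_iff_exists_coAngular_step_from (hF : IsFrobenioid F) (A : C) :
    ¬ IsGroupLikeObj F A ↔ ∃ (B : C) (φ : A ⟶ B), IsCoAngular F φ ∧ IsStep F φ := by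
  have hP : IsPreFrobenioid Φ F := hF.isPreFrobenioid
  constructor
  · intro h
    obtain ⟨x, hx⟩ := not_forall.mp h
    obtain ⟨B, φ, hφ, hdiv⟩ := hF.iii_d_under_surj A x
    refine ⟨B, φ, hφ.1, hφ.2, fun hiso => hx ?_⟩
    rw [← hdiv]
    exact isIsometry_of_isIso F hP φ
  · rintro ⟨B, φ, hco, hpre, hnot⟩ hA
    exact hnot (isIso_of_isLBInvertible_of_isPreStep F hF φ ⟨hco, hA _⟩ hpre)

/-- **Prop. 1.8 (iii)**, "alternatively": `A` is non-group-like iff there is a co-angular step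
`B → A`. [cite: MochizukiFrdI2008, Prop. 1.8] -/
theorem not_isGroupLikeObj_iff_exists_coAngular_step_to (hF : IsFrobenioid F) (A : C) :
    ¬ IsGroupLikeObj F A ↔ ∃ (B : C) (ψ : B ⟶ A), IsCoAngular F ψ ∧ IsStep F ψ := by
  have hP : IsPreFrobenioid Φ F := hF.isPreFrobenioid
  constructor
  · intro h
    obtain ⟨x, hx⟩ := not_forall.mp h
    obtain ⟨B, ψ, hψ, hdiv⟩ := hF.iii_d_over_surj A x
    refine ⟨B, ψ, hψ.1, hψ.2, fun hiso => hx ?_⟩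
    rw [← hdiv]
    unfold invDiv
    rw [show Div F ψ = 1 from isIsometry_of_isIso F hP ψ, map_one]
  · rintro ⟨B, ψ, hco, hpre, hnot⟩ hA
    haveI : IsIso (Base F ψ) := hpre.2
    obtain ⟨y, hy⟩ := (ElemFrobenioid.pullEquiv Φ (Base F ψ)).surjective (Div F ψ)
    have hiso : IsIsometry F ψ := by
      show Div F ψ = 1
      rw [← hy, hA y, map_one]
    exact hnot (isIso_of_isLBInvertible_of_isPreStep F hF ψ ⟨hco, hiso⟩ hpre)

/-- **Prop. 1.8 (iii)**, last sentence: base-isomorphic objects are simultaneously group-like.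
[cite: MochizukiFrdI2008, Prop. 1.8] -/
theorem isGroupLikeObj_iff_of_baseIsomorphic {A B : C} (h : BaseIsomorphic F A B) :
    IsGroupLikeObj F A ↔ IsGroupLikeObj F B := by
  obtain ⟨i⟩ := h
  constructor
  · intro hA x
    exact (ElemFrobenioid.pullEquiv Φ i.hom).map_eq_one_iff.mp (hA _)
  · intro hB x
    exact (ElemFrobenioid.pullEquiv Φ i.inv).map_eq_one_iff.mp (hB _)

end PreFrobenioid

end Literature.AlgebraicGeometry.Frobenioids
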